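import HarnessLib
import Summits.RiemannHypothesis.RiemannHypothesis.Theorems.SignConePointwiseCertThreeHalvesData

/-!
# Route SignCone: pointwise certificate `pwCert32` — anchored grid groups, file 20 (first half)

Support for the unconditional rungs of `SignConeOscillatory` / `SignConeInequality`
(items stmt-RiemannHypothesis-16302 / 16301). Anchored grid groups `(w, [u₀ < u₁ < …])` of the
certificate `pwCert32` (`5` groups, `286` two-point cells on `[228.5930, 251.9370]`, in
`5` slices) and their kernel checks with the corrected fast checker (`PWData.checkAGrid₂Z`:
`w ≤ wLoQ(u₀)` at the anchor, tables `pwCert32cs/pwCert32logs`, correction `pwCert32hl`, two-point cells), combined in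
`pwCert32_groups20`. Assembled in `SignConePointwiseCertThreeHalves.lean`.
-/

-- `Summit.RiemannHypothesis.RiemannHypothesis.…` repeats a namespace component by design (D-0017 layout).
set_option linter.dupNamespace false

noncomputable section

namespace Summit.RiemannHypothesis.RiemannHypothesis.Theorems.SignCone

open Literature.Analysis.ValidatedNumerics.Numerics Literature.NumberTheory.LFunctions

/-- Anchored grid groups, file 20 slice 0 (`1` groups, `53` cells on `[228.5930, 233.1077]`). [folklore] -/
def pwCert32G20s0 : List (ℚ × List ℚ) := [
  pwCert32Grp (17070578064065720845923453/3602879701896396800000000) [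
    936317, 936628, 936968, 937340, 937752, 938211, 938719, 939262, 939836, 940244, 940645, 941031, 941396, 941737, 942053, 942346,
    942617, 942868, 943103, 943324, 943535, 943737, 943933, 944207, 944479, 944754, 945039, 945347, 945683, 946056, 946476, 946953,
    947491, 948073, 948697, 949141, 949575, 949988, 950373, 950728, 951052, 951348, 951620, 951872, 952108, 952332, 952547, 952757,
    953054, 953354, 953665, 954006, 954383, 954809]]

/-- Anchored grid groups, file 20 slice 1 (`1` groups, `57` cells on `[233.1077, 237.6577]`). [folklore] -/
def pwCert32G20s1 : List (ℚ × List ℚ) := [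
  pwCert32Grp (34282103175219978320362531/7205759403792793600000000) [
    954809, 955300, 955864, 956499, 957178, 957669, 958151, 958610, 959035, 959422, 959770, 960082, 960361, 960611, 960837, 961042,
    961230, 961403, 961564, 961714, 961856, 961990, 962118, 962241, 962360, 962525, 962686, 962844, 963001, 963159, 963319, 963483,
    963652, 963829, 964015, 964212, 964423, 964655, 964908, 965185, 965491, 965830, 966208, 966629, 967098, 967619, 968192, 968802,
    969452, 970125, 970597, 971061, 971510, 971939, 972347, 972733, 973099, 973446]]

set_option maxHeartbeats 0 in
/-- **Kernel check of slice 0 of file 20.** [folklore] -/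
theorem pwCert32G20s0_ok : (pwCert32G20s0.all (pwCert32.checkAGrid₂Z pwCert32cs pwCert32logs pwCert32fac pwCert32hl)) = true := by
  decide +kernel

set_option maxHeartbeats 0 in
/-- **Kernel check of slice 1 of file 20.** [folklore] -/
theorem pwCert32G20s1_ok : (pwCert32G20s1.all (pwCert32.checkAGrid₂Z pwCert32cs pwCert32logs pwCert32fac pwCert32hl)) = true := by
  decide +kernel

end Summit.RiemannHypothesis.RiemannHypothesis.Theorems.SignCone

end
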